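import Literature.NumberTheory.LFunctions.MoebiusDyadicModuli
import Literature.NumberTheory.LFunctions.SiegelWalfiszLiouville
import Literature.NumberTheory.Sieve.VinogradovExpSumTools
import HarnessLib

/-!
# Major arcs for the Liouville exponential sum
# (stub `stub_majorArc` of the crux `HankelLift.HankelDiscrepancy`, stmt-QuantumAdvantage-18439)

For all `A B : ℕ`, for all large `N`, every `θ` with `|θ − a/q| ≤ (log N)^B/N` for some
`1 ≤ q ≤ (log N)^B` has `‖∑_{n ≤ N} λ(n) e(nθ)‖ ≤ N/(log N)^A`.

Proof (Davenport 1937; Montgomery–Vaughan §11.3 / Iwaniec–Kowalski §13.5): write `θ = a/q + β`.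
Grouping `n` by residues mod `q` (`e(na/q)` is `q`-periodic) and the PROVED Siegel–Walfisz theorem
for `λ` in arithmetic progressions (`SiegelWalfiszMoebius.liouville_progression
SiegelWalfiszMoebius_holds`, modulus range `(log x)^{2B+1}`, saving `(log x)^{A+2B+1}`, applied to
the prefixes `m > √N`; the trivial bound `m ≤ √N` for the short prefixes) bounds every prefix sum
`‖∑_{n ≤ m} λ(n) e(na/q)‖`, `m ≤ N`, by `(log N)^B (√N + C 2^{A+2B+1} N/(log N)^{A+2B+1})`; partial
summation against `e(nβ)` loses a factor `1 + 2π N|β| ≤ 8 (log N)^B`; for `N` large the total is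
`≤ N/(log N)^A`. [cite: MontgomeryVaughan2007, §11.3 Exercise 13(f) p. 384]
-/

set_option linter.dupNamespace false -- D-0017: single-problem summit ⇒ `QuantumAdvantage.QuantumAdvantage` by design

noncomputable section

namespace Summit.QuantumAdvantage.QuantumAdvantage.Theorems.HankelLift

open Finset Real Filter ArithmeticFunction
open scoped FourierTransform
open Literature.NumberTheory.Sieve.Vinogradov (afExpSum norm_afExpSum_le norm_fourierChar)
open Literature.NumberTheory.LFunctions
open Literature.NumberTheory.LFunctions.MoebiusDyadic (fourierChar_div_eq_of_natCast_eq
  norm_fourierChar_sub_one_le sum_range_succ_eq_sum_Icc)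

/-! ### Grouping by residues and summation by parts (general coefficients) -/

/-- Grouping `∑_{n ≤ X} f(n) e(na/q)` by residues mod `q` (general real coefficients `f`; the
`μ`-case is `MoebiusDyadic.afExpSum_div_eq_sum_residues`). [folklore] -/
theorem afExpSum_div_eq_sum_residues_of (f : ℕ → ℝ) (q : ℕ) [NeZero q] (a : ℤ) (X : ℕ) :
    afExpSum f X ((a : ℝ) / q) =
      ∑ b : ZMod q, (𝐞 ((b.val : ℝ) * ((a : ℝ) / q)) : ℂ) *
        ((∑ n ∈ (Icc 1 X).filter (fun n : ℕ => (n : ZMod q) = b), f n : ℝ) : ℂ) := by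
  unfold afExpSum
  rw [← Finset.sum_fiberwise (Icc 1 X) (fun n : ℕ => (n : ZMod q))]
  refine Finset.sum_congr rfl fun b _ => ?_
  push_cast
  rw [Finset.mul_sum]
  refine Finset.sum_congr rfl fun n hn => ?_
  rw [Finset.mem_filter] at hn
  rw [fourierChar_div_eq_of_natCast_eq a hn.2]
  ring

/-- From residue-class bounds to a bound at the rational point: if every progression sum
`|∑_{n ≤ X, n ≡ b (q)} f(n)|` is at most `R`, then `‖∑_{n ≤ X} f(n) e(na/q)‖ ≤ qR`. [folklore] -/
theorem norm_afExpSum_div_le_of_residues (f : ℕ → ℝ) (q : ℕ) [NeZero q] (a : ℤ) (X : ℕ)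
    (R : ℝ) (hres : ∀ b : ZMod q,
      |∑ n ∈ (Icc 1 X).filter (fun n : ℕ => (n : ZMod q) = b), f n| ≤ R) :
    ‖afExpSum f X ((a : ℝ) / q)‖ ≤ q * R := by
  rw [afExpSum_div_eq_sum_residues_of f q a X]
  calc ‖∑ b : ZMod q, (𝐞 ((b.val : ℝ) * ((a : ℝ) / q)) : ℂ) *
        ((∑ n ∈ (Icc 1 X).filter (fun n : ℕ => (n : ZMod q) = b), f n : ℝ) : ℂ)‖
      ≤ ∑ b : ZMod q, ‖(𝐞 ((b.val : ℝ) * ((a : ℝ) / q)) : ℂ) *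
        ((∑ n ∈ (Icc 1 X).filter (fun n : ℕ => (n : ZMod q) = b), f n : ℝ) : ℂ)‖ :=
        norm_sum_le _ _
    _ ≤ ∑ _b : ZMod q, R := by
        refine Finset.sum_le_sum fun b _ => ?_
        rw [norm_mul, norm_fourierChar, one_mul, Complex.norm_real, Real.norm_eq_abs]
        exact hres b
    _ = q * R := by
        rw [Finset.sum_const, Finset.card_univ, ZMod.card, nsmul_eq_mul]

/-- **Summation by parts against `e(nβ)`**: if all prefix sums `‖∑_{n ≤ m} f(n) e(nα)‖`, `m ≤ N`,
are at most `Bnd`, then `‖∑_{n ≤ N} f(n) e(n(α+β))‖ ≤ Bnd·(1 + 2π N|β|)` (`f(0) = 0`; the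
`μ`-instance is the proof of `MoebiusDyadic.norm_afExpSum_moebius_near_twoPow_le`). [folklore] -/
theorem norm_afExpSum_add_le_of_prefix (f : ℕ → ℝ) (hf0 : f 0 = 0) (N : ℕ) (α β Bnd : ℝ)
    (hpre : ∀ m : ℕ, m ≤ N → ‖afExpSum f m α‖ ≤ Bnd) :
    ‖afExpSum f N (α + β)‖ ≤ Bnd * (1 + 2 * Real.pi * N * |β|) := by
  have hBnd0 : 0 ≤ Bnd := (norm_nonneg _).trans (hpre 0 (Nat.zero_le _))
  set F : ℕ → ℂ := fun i ↦ (𝐞 ((i : ℝ) * β) : ℂ) with hFdef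
  set g : ℕ → ℂ := fun i ↦ ((f i : ℝ) : ℂ) * (𝐞 ((i : ℝ) * α) : ℂ) with hgdef
  have hg0 : g 0 = 0 := by simp [hgdef, hf0]
  have hG : ∀ m : ℕ, ∑ i ∈ Finset.range (m + 1), g i = afExpSum f m α := by
    intro m
    rw [sum_range_succ_eq_sum_Icc hg0]
    rfl
  have hS : afExpSum f N (α + β) = ∑ i ∈ Finset.range (N + 1), F i • g i := by
    have hfg0 : (fun i ↦ F i • g i) 0 = 0 := by simp [hgdef, hf0]
    rw [sum_range_succ_eq_sum_Icc hfg0]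
    unfold afExpSum
    refine Finset.sum_congr rfl fun n _ ↦ ?_
    simp only [hFdef, hgdef, smul_eq_mul]
    have : (n : ℝ) * (α + β) = (n : ℝ) * β + (n : ℝ) * α := by ring
    rw [this, AddChar.map_add_eq_mul, Circle.coe_mul]
    ring
  rw [hS, Finset.sum_range_by_parts]
  have hnf : ∀ i : ℕ, ‖F i‖ = 1 := fun i ↦ norm_fourierChar _
  have hdiff : ∀ i : ℕ, ‖F (i + 1) - F i‖ ≤ 2 * Real.pi * |β| := by
    intro i
    have : F (i + 1) - F i = F i * ((𝐞 β : ℂ) - 1) := by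
      simp only [hFdef]
      push_cast
      rw [add_mul, one_mul, AddChar.map_add_eq_mul, Circle.coe_mul]
      ring
    rw [this, norm_mul, hnf, one_mul]
    exact norm_fourierChar_sub_one_le β
  have h1 : ‖F (N + 1 - 1) • ∑ i ∈ Finset.range (N + 1), g i‖ ≤ Bnd := by
    rw [smul_eq_mul, norm_mul, hnf, one_mul, hG]
    exact hpre N le_rfl
  have h2 : ‖∑ i ∈ Finset.range (N + 1 - 1), (F (i + 1) - F i) •
      ∑ j ∈ Finset.range (i + 1), g j‖ ≤ N * (2 * Real.pi * |β| * Bnd) := by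
    calc ‖∑ i ∈ Finset.range (N + 1 - 1), (F (i + 1) - F i) • ∑ j ∈ Finset.range (i + 1), g j‖
        ≤ ∑ i ∈ Finset.range (N + 1 - 1),
            ‖(F (i + 1) - F i) • ∑ j ∈ Finset.range (i + 1), g j‖ := norm_sum_le _ _
      _ ≤ ∑ i ∈ Finset.range (N + 1 - 1), 2 * Real.pi * |β| * Bnd := by
          refine Finset.sum_le_sum fun i hi ↦ ?_
          rw [smul_eq_mul, norm_mul, hG]
          have hi' : i ≤ N := by rw [Finset.mem_range] at hi; omega
          exact mul_le_mul (hdiff i) (hpre i hi') (norm_nonneg _) (by positivity)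
      _ = N * (2 * Real.pi * |β| * Bnd) := by
          rw [Finset.sum_const, Finset.card_range, nsmul_eq_mul, Nat.add_sub_cancel]
  calc ‖F (N + 1 - 1) • ∑ i ∈ Finset.range (N + 1), g i -
        ∑ i ∈ Finset.range (N + 1 - 1), (F (i + 1) - F i) • ∑ j ∈ Finset.range (i + 1), g j‖
      ≤ ‖F (N + 1 - 1) • ∑ i ∈ Finset.range (N + 1), g i‖ +
        ‖∑ i ∈ Finset.range (N + 1 - 1), (F (i + 1) - F i) • ∑ j ∈ Finset.range (i + 1), g j‖ :=
        norm_sub_le _ _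
    _ ≤ Bnd + N * (2 * Real.pi * |β| * Bnd) := add_le_add h1 h2
    _ = Bnd * (1 + 2 * Real.pi * N * |β|) := by ring

/-! ### Eventual growth facts -/

/-- `256 (log N)^{2K} ≤ N` for all large `N`. [folklore] -/
theorem eventually_log_pow_le (K : ℕ) :
    ∀ᶠ N : ℕ in atTop, 256 * Real.log N ^ (2 * K) ≤ (N : ℝ) := by
  have h := Real.tendsto_pow_log_div_mul_add_atTop 1 0 (2 * K) one_ne_zero
  have h' : ∀ᶠ x : ℝ in atTop, Real.log x ^ (2 * K) / (1 * x + 0) < 1 / 256 :=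
    (tendsto_order.1 h).2 _ (by norm_num)
  filter_upwards [tendsto_natCast_atTop_atTop.eventually h', eventually_ge_atTop 1] with N hN hN1
  have hN0 : (0 : ℝ) < N := by exact_mod_cast hN1
  rw [one_mul, add_zero, div_lt_iff₀ hN0] at hN
  linarith

/-! ### The major-arc bound -/

/-- **Major arcs for `∑ λ(n) e(nθ)`** (`stub_majorArc` of the birth skeleton of
`HankelLift.HankelDiscrepancy`): for all `A B : ℕ`, for all large `N`, every `θ` with
`|θ − a/q| ≤ (log N)^B/N` for some `a` and `1 ≤ q ≤ (log N)^B` has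
`‖∑_{n ≤ N} λ(n) e(nθ)‖ ≤ N/(log N)^A`.  Residues mod `q` + Siegel–Walfisz for `λ` in progressions
(PROVED in the tree) on the prefixes `m > √N`, the trivial bound on `m ≤ √N`, and summation by parts.
(The coprimality of `a` and `q` is not needed.)
[cite: MontgomeryVaughan2007, §11.3 Exercise 13(f) p. 384] -/
theorem liouville_majorArc (A B : ℕ) :
    ∀ᶠ N : ℕ in atTop, ∀ θ : ℝ, ∀ q : ℕ, 1 ≤ q → (q : ℝ) ≤ Real.log N ^ B →
      ∀ a : ℤ, IsCoprime a q → |θ - a / q| ≤ Real.log N ^ B / N →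
      ‖afExpSum (⇑(liouville : ArithmeticFunction ℝ)) N θ‖ ≤ N / Real.log N ^ A := by
  -- Siegel–Walfisz for `λ`: modulus range `(log x)^(2B+1)`, saving `(log x)^K`, `K = A + 2B + 1`
  set K : ℕ := A + 2 * B + 1 with hKdef
  obtain ⟨C, hC⟩ := SiegelWalfiszMoebius.liouville_progression SiegelWalfiszMoebius_holds
    (A := ((2 * B + 1 : ℕ) : ℝ)) (by positivity) (K : ℝ)
  set C₁ : ℝ := max C 0 with hC₁def
  have hC₁0 : 0 ≤ C₁ := le_max_right _ _
  have hlog : Tendsto (fun N : ℕ => Real.log N) atTop atTop :=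
    Real.tendsto_log_atTop.comp tendsto_natCast_atTop_atTop
  filter_upwards [hlog.eventually_ge_atTop 4, hlog.eventually_ge_atTop (16 * C₁ * 2 ^ K),
    eventually_log_pow_le (A + 2 * B)] with N hL4 hLC hLN θ q hq1 hqB a _ hθ
  -- basic quantities
  set L : ℝ := Real.log N with hLdef
  have hN0 : (0 : ℝ) < N := by
    rcases Nat.eq_zero_or_pos N with h | h
    · exfalso
      have : L = 0 := by rw [hLdef, h]; simp
      linarith
    · exact_mod_cast h
  have hL1 : 1 ≤ L := by linarith
  have hL0 : 0 < L := by linarith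
  have hLB1 : 1 ≤ L ^ B := one_le_pow₀ hL1
  haveI : NeZero q := ⟨by omega⟩
  set f : ℕ → ℝ := ⇑(liouville : ArithmeticFunction ℝ) with hfdef
  have hf : ∀ n : ℕ, f n = (liouville n : ℝ) := fun n => by simp [hfdef]
  have hf0 : f 0 = 0 := by simp [hfdef]
  set β : ℝ := θ - a / q with hβdef
  -- the uniform bound on residue-class prefix sums
  set R : ℝ := Real.sqrt N + C₁ * 2 ^ K * N / L ^ K with hRdef
  have hR0 : 0 ≤ R := by positivity
  have hres : ∀ m : ℕ, m ≤ N → ∀ b : ZMod q,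
      |∑ n ∈ (Icc 1 m).filter (fun n : ℕ => (n : ZMod q) = b), f n| ≤ R := by
    intro m hm b
    have hsum : ∑ n ∈ (Icc 1 m).filter (fun n : ℕ => (n : ZMod q) = b), f n =
        ∑ n ∈ (Icc 1 ⌊(m : ℝ)⌋₊).filter (fun n : ℕ => (n : ZMod q) = b), (liouville n : ℝ) := by
      rw [Nat.floor_natCast]
      exact Finset.sum_congr rfl fun n _ => hf n
    rw [hsum]
    have hmR : (m : ℝ) ≤ N := by exact_mod_cast hm
    rcases le_or_gt (m : ℝ) (Real.sqrt N) with hsmall | hlarge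
    · -- short prefix: trivial bound
      calc _ ≤ (m : ℝ) :=
            SiegelWalfiszLiouville.abs_sum_liouville_progression_le_self b (Nat.cast_nonneg m)
        _ ≤ Real.sqrt N := hsmall
        _ ≤ R := by rw [hRdef]; exact le_add_of_nonneg_right (by positivity)
    · -- long prefix: Siegel–Walfisz
      have hm0 : (0 : ℝ) < m := lt_of_le_of_lt (Real.sqrt_nonneg _) hlarge
      have hlogm : L / 2 ≤ Real.log m := by
        have h1 : Real.log (Real.sqrt N) = L / 2 := by
          rw [hLdef, Real.log_sqrt hN0.le]
        rw [← h1]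
        exact Real.log_le_log (Real.sqrt_pos.mpr hN0) hlarge.le
      have hlogm2 : 2 ≤ Real.log m := by linarith
      have hm2 : (2 : ℝ) ≤ m := by
        by_contra h
        push Not at h
        have : Real.log m < Real.log 2 := Real.log_lt_log hm0 h
        have h2 : Real.log 2 < 1 := Real.log_two_lt_d9.trans (by norm_num)
        linarith
      -- modulus range: `q ≤ L^B ≤ (log m)^(2B+1)`
      have hqm : (q : ℝ) ≤ Real.log m ^ (((2 * B + 1 : ℕ) : ℝ)) := by
        rw [Real.rpow_natCast]
        refine hqB.trans ?_
        have h2B : (2 : ℝ) ^ B ≤ Real.log m ^ (B + 1) :=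
          calc (2 : ℝ) ^ B ≤ 2 ^ (B + 1) := pow_le_pow_right₀ (by norm_num) (by omega)
            _ ≤ Real.log m ^ (B + 1) := pow_le_pow_left₀ (by norm_num) hlogm2 _
        calc L ^ B ≤ (2 * Real.log m) ^ B :=
              pow_le_pow_left₀ hL0.le (by linarith) _
          _ = 2 ^ B * Real.log m ^ B := mul_pow _ _ _
          _ ≤ Real.log m ^ (B + 1) * Real.log m ^ B :=
              mul_le_mul_of_nonneg_right h2B (pow_nonneg (by linarith) _)
          _ = Real.log m ^ (2 * B + 1) := by rw [← pow_add]; ring_nf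
      have hSW := hC m hm2 q hq1 hqm b
      rw [Real.rpow_natCast] at hSW
      refine hSW.trans ?_
      have hlogmK : (L / 2) ^ K ≤ Real.log m ^ K := pow_le_pow_left₀ (by positivity) hlogm _
      have hL2K : 0 < (L / 2) ^ K := by positivity
      calc C * m / Real.log m ^ K ≤ C₁ * N / (L / 2) ^ K := by
            rw [div_le_div_iff₀ (lt_of_lt_of_le hL2K hlogmK) hL2K]
            calc C * m * (L / 2) ^ K ≤ C₁ * m * (L / 2) ^ K := by gcongr; exact le_max_left _ _
              _ ≤ C₁ * N * (L / 2) ^ K := by gcongr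
              _ ≤ C₁ * N * Real.log m ^ K := by gcongr
        _ = C₁ * 2 ^ K * N / L ^ K := by
            rw [div_pow]
            field_simp
        _ ≤ R := by rw [hRdef]; exact le_add_of_nonneg_left (Real.sqrt_nonneg _)
  -- prefix bounds at the rational point `a/q`
  have hpre : ∀ m : ℕ, m ≤ N → ‖afExpSum f m ((a : ℝ) / q)‖ ≤ L ^ B * R := by
    intro m hm
    refine (norm_afExpSum_div_le_of_residues f q a m R (hres m hm)).trans ?_
    exact mul_le_mul_of_nonneg_right hqB hR0
  -- summation by parts
  have hθ' : θ = (a : ℝ) / q + β := by rw [hβdef]; ring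
  have hmain := norm_afExpSum_add_le_of_prefix f hf0 N ((a : ℝ) / q) β (L ^ B * R) hpre
  rw [← hθ'] at hmain
  refine hmain.trans ?_
  -- `N |β| ≤ L^B`, so the partial-summation factor is `≤ 8 L^B`
  have hNβ : (N : ℝ) * |β| ≤ L ^ B := by
    calc (N : ℝ) * |β| ≤ N * (L ^ B / N) := mul_le_mul_of_nonneg_left hθ hN0.le
      _ = L ^ B := by field_simp
  have hpi : Real.pi ≤ 7 / 2 := by have := Real.pi_lt_d2; linarith
  have hfac : 1 + 2 * Real.pi * N * |β| ≤ 8 * L ^ B := by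
    have : 2 * Real.pi * N * |β| ≤ 7 * L ^ B := by
      calc 2 * Real.pi * N * |β| = 2 * Real.pi * (N * |β|) := by ring
        _ ≤ 2 * (7 / 2) * L ^ B := by gcongr
        _ = 7 * L ^ B := by ring
    linarith
  calc L ^ B * R * (1 + 2 * Real.pi * N * |β|) ≤ L ^ B * R * (8 * L ^ B) :=
        mul_le_mul_of_nonneg_left hfac (by positivity)
    _ = 8 * L ^ (2 * B) * Real.sqrt N + 8 * C₁ * 2 ^ K * N / L ^ (A + 1) := by
        rw [hRdef, hKdef]
        field_simp
        ring
    _ ≤ N / L ^ A / 2 + N / L ^ A / 2 := by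
        gcongr ?_ + ?_
        · -- `16 L^(A+2B) ≤ √N`
          have h16 : 16 * L ^ (A + 2 * B) ≤ Real.sqrt N := by
            have h := Real.sqrt_le_sqrt hLN
            rwa [show (256 : ℝ) * L ^ (2 * (A + 2 * B)) = (16 * L ^ (A + 2 * B)) ^ 2 by ring,
              Real.sqrt_sq (by positivity)] at h
          rw [le_div_iff₀ (by norm_num : (0 : ℝ) < 2), le_div_iff₀ (by positivity)]
          calc 8 * L ^ (2 * B) * Real.sqrt N * 2 * L ^ A
              = (16 * L ^ (A + 2 * B)) * Real.sqrt N := by ring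
            _ ≤ Real.sqrt N * Real.sqrt N :=
                mul_le_mul_of_nonneg_right h16 (Real.sqrt_nonneg _)
            _ = N := Real.mul_self_sqrt hN0.le
        · -- `16 C₁ 2^K ≤ L`
          have hkey : 8 * C₁ * 2 ^ K * N / L ^ (A + 1) = (8 * C₁ * 2 ^ K / L) * (N / L ^ A) := by
            rw [pow_succ L A, div_mul_div_comm, mul_comm L (L ^ A)]
          have h2 : 8 * C₁ * 2 ^ K / L ≤ 1 / 2 := by
            rw [div_le_iff₀ hL0]
            linarith
          calc 8 * C₁ * 2 ^ K * N / L ^ (A + 1) = (8 * C₁ * 2 ^ K / L) * (N / L ^ A) := hkey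
            _ ≤ (1 / 2) * (N / L ^ A) := mul_le_mul_of_nonneg_right h2 (by positivity)
            _ = N / L ^ A / 2 := by ring
    _ = N / L ^ A := by ring

/-- **Registered stub `stub_majorArc`** of the birth skeleton `Cruxes/HankelDiscrepancy/Lines/birth.lean`
(crux `HankelLift.HankelDiscrepancy`, stmt-QuantumAdvantage-18439), verbatim signature, proved by
`liouville_majorArc`. [cite: MontgomeryVaughan2007, §11.3 Exercise 13(f) p. 384] -/
theorem stub_majorArc :
    ∀ A B : ℕ, ∀ᶠ N : ℕ in atTop, ∀ θ : ℝ, ∀ q : ℕ, 1 ≤ q → (q : ℝ) ≤ Real.log N ^ B →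
      ∀ a : ℤ, IsCoprime a q → |θ - a / q| ≤ Real.log N ^ B / N →
      ‖afExpSum (⇑(liouville : ArithmeticFunction ℝ)) N θ‖ ≤ N / Real.log N ^ A :=
  liouville_majorArc

end Summit.QuantumAdvantage.QuantumAdvantage.Theorems.HankelLift
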